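import Summits.HodgeConjecture.CorCM.QuadraticCMFamiliesNonisomorphic
import Summits.HodgeConjecture.CorCM.Assembly.EllipticCurveEndomorphismAlgebra
import Literature.AlgebraicGeometry.ComplexMultiplication.CMTypeConjugateIsogeny
import Literature.AlgebraicGeometry.Milne1999.CMHodgeHypothesisFromCMTypedProducts
import Literature.AlgebraicGeometry.Milne1999.CMTypeSimpleIsogenyFactors
import Literature.AlgebraicGeometry.HodgeTheory.AbelianVarietyHodgeFullnessHolds
import HarnessLib

/-!
# CM elliptic curves are isogenous iff their CM fields are isomorphic; products of PAIRWISE NON-ISOGENOUS CM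
# elliptic curves (Moonen–Zarhin Cor. (3.9), CM case, literally)

COR-CM (cell `pub-hodgecm2`, seat `b16` gen 35), count-neutral, theorems only (no definition, no named fact).
Sequel of `QuadraticCMFamiliesNonisomorphic` (separating ⟺ CM fields pairwise non-isomorphic, for imaginary
quadratic fields): here the hypothesis is moved from the FIELDS to the CURVES, as printed — Moonen–Zarhin 1999
Cor. (3.9) (Imai) «Let `X₁, …, X_n` be elliptic curves over `ℂ`, no two of which are isogenous … Then
`Hg(X) = Hg(X₁) × ⋯ × Hg(X_n)`. In particular, every product of elliptic curves satisfies condition (D)».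

For realisations `(A, ι, θ)`, `(A′, ι′, θ′)` (`IsCMTypeRealisation`, read on `H¹`) of CM types `Φ`, `Φ′` of CM
fields `K`, `K′` of degree `2` (so `A`, `A′` are CM elliptic curves, `dim = 1`):

* **`isIsogenous_of_ringEquiv`** — `K′ ≃ K` ⟹ `A ∼ A′`: transport `(A′, ι′, θ′)` along `e` to a realisation over
  `K` of the type `Φ′ᵉ` (`IsCMTypeRealisation.transport`); a quadratic field has exactly the two CM types `Φ`, `Φ̄`,
  so `Φ′ᵉ = Φ` — then Shimura 1998 §6.1 Cor. of Thm. 2 (`thm2_cor_of_riemann`, a tree theorem under Riemann's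
  theorem `deligneMilne1982_Thm_6_20_full_holds`) — or `Φ′ᵉ = Φ̄` — then Deligne's antilinear isogeny
  `A_Φ → A_{Φ̄}` (`exists_antilinear_isogeny_of_riemann`);
* **`nonempty_ringEquiv_of_isIsogenous`** — `A ∼ A′` ⟹ `K ≃ K′`: with `a ∈ 𝓞_K`, `a² = -d` and `a′ ∈ 𝓞_{K′}`,
  `a′² = -d′` (`d, d′` squarefree, `ImaginaryQuadratic.exists_sq_eq_neg_squarefree`) the endomorphism algebra
  `End⁰(A′)` — a FIELD of `ℚ`-dimension `≤ 2` (seat b26: `PeriodCurve.isField_endAlgebra_of_dim_eq_one`,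
  `finrank_endAlgebra_le_two_of_dim_eq_one`) — contains `ι′(a′)` and, through the injective transport
  `End⁰(A) → End⁰(A′)` along the isogeny (`IsIsogeny.exists_algHom_injective`), an element of square `-d`;
  two square roots of negative integers in one quadratic field have square product
  (`QuadEnd.isSquare_mul_of_sq_eq_neg`, coordinates in the basis `1, y`), so `d d′` is a square and `K ≃ K′`
  (`ImaginaryQuadratic.not_isSquare_mul_of_isEmpty_ringEquiv`);
* **`isIsogenous_iff_nonempty_ringEquiv`** — CM elliptic curves are isogenous iff their CM fields are isomorphic
  (the classical dictionary "isogeny classes of CM elliptic curves over `ℂ` ↔ imaginary quadratic fields", one class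
  per field being Shimura's Corollary);
* for families: **`isSeparatingFamily_iff_pairwise_not_isIsogenous`** (Kubota separation ⟺ realisations pairwise
  non-isogenous), `isNondegenerateFamily_of_pairwise_not_isIsogenous` (Deligne's rank `= n + 1`, i.e.
  `dim MT(E₁ × ⋯ × E_n) = n + 1`, equivalently `Hg(X) = Hg(X₁) × ⋯ × Hg(X_n)` is a torus of rank `n`),
  `hodgeClassSpan_prod_eq_divisorClassesSpan_of_pairwise_not_isIsogenous`
  and **`hodgeConjectureFor_prod_of_pairwise_not_isIsogenous`** — `B = D` and the Hodge conjecture on every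
  `⨁_{j<N} E_{π j}` for CM elliptic curves `E_i` NO TWO OF WHICH ARE ISOGENOUS: Moonen–Zarhin Cor. (3.9), CM case, as
  printed, through the CM-type combinatorics (the Hodge-theoretic proof for all products of elliptic curves is the
  tree's `HodgeTheory/EllipticCurvesProductsHodgeConjecture`).

Sources: Moonen–Zarhin, Math. Ann. 315 (1999), Cor. (3.9) and (2.1); Shimura 1998 §6.1 Cor. of Thm. 2, §18.2 (1);
Deligne LNM 900 §5 (b); Silverman AEC III Cor. 9.4 (`End⁰` of an elliptic curve).  Not a step of `HC_CM`/`HC_AV`;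
wording of record untouched.
-/

set_option autoImplicit false

noncomputable section

open CategoryTheory CategoryTheory.Limits NumberField
open scoped BigOperators

namespace Summit.HodgeConjecture.CorCM

open Literature.NumberTheory.ComplexMultiplication
open Literature.NumberTheory.Automorphic
open Literature.AlgebraicGeometry.Motives (AbelianVariety CMType)
open Literature.AlgebraicGeometry.HodgeTheory
open Literature.AlgebraicGeometry.ComplexMultiplication
open Literature.AlgebraicGeometry.VanGeemen1994 (hodgeClassSpan)
open Literature.AlgebraicGeometry.Pohlmann1968
open Literature.Barriers.HodgeConjecture (divisorClassesSpan)

/-! ### Two square roots of negative integers in a field of dimension `≤ 2` over `ℚ` -/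

namespace QuadEnd

variable {F : Type*} [Ring F] [Algebra ℚ F]

/-- **Two square roots of negative integers in one quadratic field have square product.**  Let `F` be a
`ℚ`-algebra which is a field with `0 < dim_ℚ F ≤ 2`, `y² = -m`, `x² = -n` (`m, n ≥ 1`).  Then `1, y` is a `ℚ`-basis,
`x = p + q y`, and `x² = (p² - q²m) + 2pq·y = -n` forces `p = 0`, `q² m = n`, so `m n = (q m)²`.
(For `F = End⁰` of a CM elliptic curve.) [folklore] -/
theorem isSquare_mul_of_sq_eq_neg (hF : IsField F) (hpos : 0 < Module.finrank ℚ F) (h2 : Module.finrank ℚ F ≤ 2)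
    {y x : F} {m n : ℕ} (hm : m ≠ 0) (hn : n ≠ 0) (hy : y ^ 2 = -(m : F)) (hx : x ^ 2 = -(n : F)) :
    IsSquare (m * n) := by
  haveI : Nontrivial F := hF.nontrivial
  haveI : Module.Finite ℚ F := Module.finite_of_finrank_pos hpos
  letI : CommRing F := { toRing := ‹Ring F›, mul_comm := hF.mul_comm }
  have hinj : Function.Injective (algebraMap ℚ F) := (algebraMap ℚ F).injective
  have hm0 : (0 : ℚ) < m := Nat.cast_pos.2 (Nat.pos_of_ne_zero hm)
  have hn0 : (0 : ℚ) < n := Nat.cast_pos.2 (Nat.pos_of_ne_zero hn)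
  have hmF : (m : F) = algebraMap ℚ F m := (map_natCast _ m).symm
  have hnF : (n : F) = algebraMap ℚ F n := (map_natCast _ n).symm
  -- `y` is not rational
  have hy1 : ∀ r : ℚ, y ≠ algebraMap ℚ F r := by
    intro r hr
    have h1 : algebraMap ℚ F (r ^ 2 + m) = 0 := by
      rw [map_add, map_pow, ← hr, hy, hmF, neg_add_cancel]
    have h2 : r ^ 2 + m = 0 := hinj (by rw [h1, map_zero])
    nlinarith [sq_nonneg r]
  -- `1, y` is a basis of `F`
  have hli : LinearIndependent ℚ ![(1 : F), y] := by
    rw [LinearIndependent.pair_iff]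
    intro s t hst
    by_cases ht : t = 0
    · subst ht
      rw [zero_smul, add_zero, Algebra.smul_def, mul_one] at hst
      exact ⟨hinj (by rw [hst, map_zero]), rfl⟩
    · exfalso
      refine hy1 (-(s / t)) ?_
      rw [Algebra.smul_def, mul_one, Algebra.smul_def] at hst
      have hTT : algebraMap ℚ F t⁻¹ * algebraMap ℚ F t = 1 := by rw [← map_mul, inv_mul_cancel₀ ht, map_one]
      rw [div_eq_mul_inv, map_neg, map_mul]
      linear_combination (algebraMap ℚ F t⁻¹) * hst - y * hTT
  have hcard : Fintype.card (Fin 2) = Module.finrank ℚ F :=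
    le_antisymm hli.fintype_card_le_finrank (by rw [Fintype.card_fin]; exact h2)
  let b : Module.Basis (Fin 2) ℚ F := basisOfLinearIndependentOfCardEqFinrank hli hcard
  have hb : ⇑b = ![(1 : F), y] := coe_basisOfLinearIndependentOfCardEqFinrank hli hcard
  -- coordinates of `x`
  obtain ⟨p, q, hpq⟩ : ∃ p q : ℚ, x = p • (1 : F) + q • y := by
    refine ⟨b.repr x 0, b.repr x 1, ?_⟩
    have hsum := b.sum_repr x
    rw [Fin.sum_univ_two, hb] at hsum
    exact hsum.symm
  -- `x² = (p² - q² m) • 1 + (2 p q) • y`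
  have hx2 : x ^ 2 = (p ^ 2 - q ^ 2 * m) • (1 : F) + (2 * p * q) • y := by
    rw [hpq, Algebra.smul_def, Algebra.smul_def, Algebra.smul_def, Algebra.smul_def, mul_one, mul_one, map_sub,
      map_mul, map_pow, map_pow, map_natCast, map_mul, map_mul, map_ofNat]
    linear_combination (algebraMap ℚ F q) ^ 2 * hy
  have hn1 : -(n : F) = (-(n : ℚ)) • (1 : F) + (0 : ℚ) • y := by
    rw [zero_smul, add_zero, neg_smul, Algebra.smul_def, mul_one, hnF]
  obtain ⟨h1, h2⟩ := LinearIndependent.pair_iffₛ.1 hli _ _ _ _ (hx2.symm.trans (hx.trans hn1))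
  rcases mul_eq_zero.1 h2 with h3 | hq
  · have hp : p = 0 := by simpa using h3
    rw [hp] at h1
    refine Rat.isSquare_natCast_iff.1 ⟨q * m, ?_⟩
    push_cast
    nlinarith [h1]
  · rw [hq] at h1
    nlinarith [sq_nonneg p, h1]

end QuadEnd

/-! ### Isogenous ⟺ isomorphic CM fields, for CM elliptic curves -/

section Pair

variable {K K' : Type} [Field K] [NumberField K] [IsCMField K] [Field K'] [NumberField K'] [IsCMField K']
  {Φ : CMType K} {Φ' : CMType K'} {A A' : AbelianVariety ℂ} {ι : 𝓞 K →+* End A} {ι' : 𝓞 K' →+* End A'}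
  {θ : K →+* Module.End ℂ (complexBetti A.X 1)} {θ' : K' →+* Module.End ℂ (complexBetti A'.X 1)}

omit [IsCMField K'] in
/-- **Isomorphic imaginary quadratic CM fields ⟹ isogenous CM elliptic curves** (Shimura 1998 §6.1 Cor. of
Thm. 2 «any two abelian varieties of the same CM-type are isogenous», after transporting `(A′, ι′, θ′)` along
`e : K′ ≃ K`; the transported type is `Φ` or `Φ̄`, and in the second case Deligne's antilinear isogeny
`A_Φ → A_{Φ̄}` (LNM 900 §5 (b)) applies).  Both inputs are tree theorems under Riemann's theorem
`deligneMilne1982_Thm_6_20_full_holds`. [cite: Shimura1998, §6.1 Corollary of Theorem 2 (p. 41)]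
[cite: Deligne1982HodgeCycles, §5 (b) (TeXed re-edition p. 38)] -/
theorem isIsogenous_of_ringEquiv (hK : Module.finrank ℚ K = 2) (hA : IsCMTypeRealisation Φ A ι θ)
    (hA' : IsCMTypeRealisation Φ' A' ι' θ') (e : K' ≃+* K) : AbelianVariety.IsIsogenous A A' := by
  have hT := hA'.transport e
  obtain ⟨s⟩ := (inferInstance : Nonempty (K →+* ℂ))
  by_cases h : (s ∈ Φ.1 ↔ s ∈ (PicardCM.CMCode.cmTypeMap e Φ').1)
  · have hΦΨ : PicardCM.CMCode.cmTypeMap e Φ' = Φ := by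
      apply Subtype.ext
      ext t
      rcases QuadGen.eq_or_eq_conj_smul Φ hK s t with rfl | rfl
      · exact h.symm
      · rw [(isCMTypeWith_conj Φ).rho_smul_mem_iff, (isCMTypeWith_conj (PicardCM.CMCode.cmTypeMap e Φ')).rho_smul_mem_iff,
          not_iff_not]
        exact h.symm
    rw [hΦΨ] at hT
    obtain ⟨g, hg, -⟩ := thm2_cor_of_riemann deligneMilne1982_Thm_6_20_full_holds K Φ A ι θ A' _ _ hA hT
    exact ⟨g, hg⟩
  · have hconj : ∀ φ : K →+* ℂ, φ ∈ (PicardCM.CMCode.cmTypeMap e Φ').1 ↔ ComplexEmbedding.conjugate φ ∈ Φ.1 := by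
      intro φ
      rw [← conj_smul_eq_conjugate, (isCMTypeWith_conj Φ).rho_smul_mem_iff]
      rcases QuadGen.eq_or_eq_conj_smul Φ hK s φ with rfl | rfl
      · tauto
      · rw [(isCMTypeWith_conj Φ).rho_smul_mem_iff, (isCMTypeWith_conj (PicardCM.CMCode.cmTypeMap e Φ')).rho_smul_mem_iff,
          not_not]
        tauto
    obtain ⟨g, hg, -⟩ := exists_antilinear_isogeny_of_riemann deligneMilne1982_Thm_6_20_full_holds hconj hA hT
    exact ⟨g, hg⟩

omit [IsCMField K] [IsCMField K'] in
/-- A realisation of a CM type of a field of degree `2` is an elliptic curve. [cite: Shimura1998, §5.2 (`[F : ℚ] = 2n`)] -/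
theorem dim_eq_one_of_isCMTypeRealisation_of_finrank_eq_two (hK : Module.finrank ℚ K = 2)
    (hA : IsCMTypeRealisation Φ A ι θ) : A.dim = 1 := by
  have h := Literature.AlgebraicGeometry.Motives.schemeDim_eq_holds hA.1
  rw [hK] at h
  exact h

omit [NumberField K] [IsCMField K] in
/-- An element `a` with `a² = -d` (`d ∈ ℕ`) of a number field is an algebraic integer, and `ι(a) ∈ End(A)` has square
`-d` in `End⁰(A)`. [folklore] -/
theorem exists_endAlgebra_sq_eq_neg (ι : 𝓞 K →+* End A) {a : K} {d : ℕ} (ha : a ^ 2 = -(d : K)) :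
    ∃ x : A.endAlgebra, (∃ α : 𝓞 K, x = AbelianVariety.endAlgebra.of A (ι α)) ∧ x ^ 2 = -(d : A.endAlgebra) := by
  have hint : IsIntegral ℤ a := by
    refine ⟨Polynomial.X ^ 2 + Polynomial.C (d : ℤ), Polynomial.monic_X_pow_add_C _ two_ne_zero, ?_⟩
    rw [Polynomial.eval₂_add, Polynomial.eval₂_X_pow, Polynomial.eval₂_C, ha, map_natCast, neg_add_cancel]
  let α : 𝓞 K := ⟨a, hint⟩
  have hα : α ^ 2 = -((d : ℕ) : 𝓞 K) := by
    apply RingOfIntegers.coe_injective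
    rw [map_pow, map_neg, map_natCast, RingOfIntegers.map_mk]
    exact ha
  refine ⟨AbelianVariety.endAlgebra.of A (ι α), ⟨α, rfl⟩, ?_⟩
  rw [← map_pow, ← map_pow, hα, map_neg, map_neg, map_natCast, map_natCast]

/-- **Isogenous CM elliptic curves have isomorphic CM fields** (Moonen–Zarhin (2.1), `g = 1`, Type IV(1,1): `End⁰`
of a CM elliptic curve is ITS imaginary quadratic field, an isogeny invariant); on the side of `A` only a (unital)
action `ι : 𝓞_K → End(A)` of the integers of the imaginary quadratic field `K` is used.  Proof in the tree's terms:
`End⁰(A′)` is a field of `ℚ`-dimension `≤ 2` containing `ι′(a′)` (`a′² = -d′`) and the isogeny-transport of `ι(a)`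
(`a² = -d`), so `d d′` is a square, `d = d′` and `K ≅ ℚ[X]/(X² + d) ≅ K′`.
[cite: MoonenZarhin1999LowDim, §2 (2.1) (g = 1)] [cite: Shimura1998, §18.2 (1)] -/
theorem nonempty_ringEquiv_of_isIsogenous (hK : Module.finrank ℚ K = 2) (hK' : Module.finrank ℚ K' = 2)
    (ιA : 𝓞 K →+* End A) (hA' : IsCMTypeRealisation Φ' A' ι' θ') (h : AbelianVariety.IsIsogenous A A') :
    Nonempty (K ≃+* K') := by
  obtain ⟨a, d, hd, ha⟩ := ImaginaryQuadratic.exists_sq_eq_neg_squarefree (K := K) hK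
  obtain ⟨a', d', hd', ha'⟩ := ImaginaryQuadratic.exists_sq_eq_neg_squarefree (K := K') hK'
  obtain ⟨x, -, hx⟩ := exists_endAlgebra_sq_eq_neg ιA ha
  obtain ⟨x', -, hx'⟩ := exists_endAlgebra_sq_eq_neg ι' ha'
  obtain ⟨f, hf⟩ := h
  obtain ⟨⟨Θ, -⟩, -⟩ := hf.exists_algHom_injective
  have hy : (Θ x) ^ 2 = -(d : A'.endAlgebra) := by rw [← map_pow, hx, map_neg, map_natCast]
  have hdim : A'.dim = 1 := dim_eq_one_of_isCMTypeRealisation_of_finrank_eq_two hK' hA'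
  have hsq : IsSquare (d * d') :=
    QuadEnd.isSquare_mul_of_sq_eq_neg (PeriodCurve.isField_endAlgebra_of_dim_eq_one hdim)
      (PeriodCurve.one_le_finrank_endAlgebra_of_dim_eq_one hdim) (PeriodCurve.finrank_endAlgebra_le_two_of_dim_eq_one hdim)
      hd.ne_zero hd'.ne_zero hy hx'
  by_contra hne
  rw [not_nonempty_iff] at hne
  exact ImaginaryQuadratic.not_isSquare_mul_of_isEmpty_ringEquiv hK hK' hd hd' ha ha' hne hsq

/-- **CM elliptic curves are isogenous iff their CM fields are isomorphic** (realisations of CM types of imaginary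
quadratic fields; the dictionary "isogeny classes of CM elliptic curves over `ℂ` ↔ imaginary quadratic fields").
[cite: Shimura1998, §6.1 Corollary of Theorem 2 (p. 41)] [cite: MoonenZarhin1999LowDim, §2 (2.1) (g = 1)] -/
theorem isIsogenous_iff_nonempty_ringEquiv (hK : Module.finrank ℚ K = 2) (hK' : Module.finrank ℚ K' = 2)
    (hA : IsCMTypeRealisation Φ A ι θ) (hA' : IsCMTypeRealisation Φ' A' ι' θ') :
    AbelianVariety.IsIsogenous A A' ↔ Nonempty (K ≃+* K') :=
  ⟨nonempty_ringEquiv_of_isIsogenous hK hK' ι hA', fun ⟨e⟩ => isIsogenous_of_ringEquiv hK hA hA' e.symm⟩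

end Pair

/-! ### Families: pairwise non-isogenous CM elliptic curves (Moonen–Zarhin Cor. (3.9), CM case, literally) -/

section Family

variable {I : Type} {K : I → Type} [∀ i, Field (K i)] [∀ i, NumberField (K i)] [∀ i, IsCMField (K i)]
  {Φ : ∀ i, CMType (K i)} {A : I → AbelianVariety ℂ} {ι : ∀ i, 𝓞 (K i) →+* End (A i)}
  {θ : ∀ i, K i →+* Module.End ℂ (complexBetti (A i).X 1)}

/-- Realisations of CM types of imaginary quadratic fields are pairwise non-isogenous iff their CM fields are pairwise
non-isomorphic. [cite: Shimura1998, §6.1 Corollary of Theorem 2 (p. 41)] [cite: MoonenZarhin1999LowDim, §2 (2.1) (g = 1)] -/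
theorem pairwise_not_isIsogenous_iff_pairwise_isEmpty_ringEquiv (hK : ∀ i, Module.finrank ℚ (K i) = 2)
    (hA : ∀ i, IsCMTypeRealisation (Φ i) (A i) (ι i) (θ i)) :
    (∀ i j, i ≠ j → ¬AbelianVariety.IsIsogenous (A i) (A j)) ↔ ∀ i j, i ≠ j → IsEmpty (K i ≃+* K j) := by
  refine forall₃_congr fun i j _ => ?_
  rw [isIsogenous_iff_nonempty_ringEquiv (hK i) (hK j) (hA i) (hA j), not_nonempty_iff]

/-- **Kubota separation ⟺ pairwise non-isogenous**, for CM elliptic curves realising CM types of imaginary quadratic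
fields. [cite: Kubota1965, §2 (p. 115)] [cite: MoonenZarhin1999LowDim, Cor. (3.9)] -/
theorem isSeparatingFamily_iff_pairwise_not_isIsogenous (hK : ∀ i, Module.finrank ℚ (K i) = 2)
    (hA : ∀ i, IsCMTypeRealisation (Φ i) (A i) (ι i) (θ i)) :
    CMAlgebra.IsSeparatingFamily Φ ↔ ∀ i j, i ≠ j → ¬AbelianVariety.IsIsogenous (A i) (A j) := by
  rw [isSeparatingFamily_iff_pairwise_isEmpty_ringEquiv hK, pairwise_not_isIsogenous_iff_pairwise_isEmpty_ringEquiv hK hA]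

variable [Fintype I] [Nonempty I]

/-- **Nondegeneracy for pairwise non-isogenous CM elliptic curves**: Deligne's rank of `(Φ_i)` is `|I| + 1`, i.e.
`rk X*(MT(E_1 × ⋯ × E_n)) = n + 1` («`Hg(X) = Hg(X₁) × ⋯ × Hg(X_n)`», a torus of rank `n`; `MT = 𝔾_m · Hg` has rank
`n + 1`) for CM elliptic curves no two of which are isogenous — Moonen–Zarhin Cor. (3.9) (Imai), CM case, in rank form.
[cite: MoonenZarhin1999LowDim, Cor. (3.9)] [cite: Deligne1982HodgeCycles, I Ex. 3.7 (c) (p. 26)] -/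
theorem isNondegenerateFamily_of_pairwise_not_isIsogenous (hK : ∀ i, Module.finrank ℚ (K i) = 2)
    (hA : ∀ i, IsCMTypeRealisation (Φ i) (A i) (ι i) (θ i))
    (hni : ∀ i j, i ≠ j → ¬AbelianVariety.IsIsogenous (A i) (A j)) : CMAlgebra.IsNondegenerateFamily Φ :=
  isNondegenerateFamily_of_pairwise_isEmpty_ringEquiv hK
    ((pairwise_not_isIsogenous_iff_pairwise_isEmpty_ringEquiv hK hA).1 hni) Φ

/-- **`Bᵐ ⊗ ℂ = Dᵐ ⊗ ℂ` on every product `⨁_{j<N} E_{π j}` of CM elliptic curves no two of which are isogenous**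
(realisations of CM types of imaginary quadratic fields): Moonen–Zarhin Cor. (3.9) «every product of elliptic curves
satisfies condition (D)», CM case, via Deligne's rank. [cite: MoonenZarhin1999LowDim, Cor. (3.9)] -/
theorem hodgeClassSpan_prod_eq_divisorClassesSpan_of_pairwise_not_isIsogenous
    (hK : ∀ i, Module.finrank ℚ (K i) = 2) (hA : ∀ i, IsCMTypeRealisation (Φ i) (A i) (ι i) (θ i))
    (hni : ∀ i j, i ≠ j → ¬AbelianVariety.IsIsogenous (A i) (A j)) {N : ℕ} (π : Fin N → I) (m : ℕ) :
    hodgeClassSpan (⨁ fun j : Fin N => A (π j)).dim (⨁ fun j : Fin N => A (π j)).X m =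
      divisorClassesSpan (⨁ fun j : Fin N => A (π j)).X (⨁ fun j : Fin N => A (π j)).dim m :=
  hodgeClassSpan_prod_eq_divisorClassesSpan_of_pairwise_isEmpty_ringEquiv hK
    ((pairwise_not_isIsogenous_iff_pairwise_isEmpty_ringEquiv hK hA).1 hni) hA π m

/-- **The Hodge conjecture for every product `⨁_{j<N} E_{π j}` (every `∏_i E_i^{k_i}`) of CM elliptic curves
`E_1, …, E_n`, NO TWO OF WHICH ARE ISOGENOUS** — the CM case of Moonen–Zarhin Cor. (3.9) with the hypothesis as
printed, UNCONDITIONAL, through the CM-type combinatorics (realisations of CM types of imaginary quadratic fields).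
[cite: MoonenZarhin1999LowDim, Cor. (3.9)] [cite: Gordon1999HodgeAVSurvey, §3 Theorem and 10.10] -/
theorem hodgeConjectureFor_prod_of_pairwise_not_isIsogenous (hK : ∀ i, Module.finrank ℚ (K i) = 2)
    (hA : ∀ i, IsCMTypeRealisation (Φ i) (A i) (ι i) (θ i))
    (hni : ∀ i j, i ≠ j → ¬AbelianVariety.IsIsogenous (A i) (A j)) {N : ℕ} (π : Fin N → I) :
    HodgeConjectureFor (⨁ fun j : Fin N => A (π j)).dim (⨁ fun j : Fin N => A (π j)).X :=
  hodgeConjectureFor_prod_of_pairwise_isEmpty_ringEquiv hK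
    ((pairwise_not_isIsogenous_iff_pairwise_isEmpty_ringEquiv hK hA).1 hni) hA π

end Family

end Summit.HodgeConjecture.CorCM

end
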